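import Mathlib
import Summits.CriticalPhenomena.CardyFormulaZ2.Theorems.CardyFlipRussoSquareFromVoronoiHubDefs
import Literature.Probability.RandomPlanarGeometry.PlanarDomainsTopology
import Literature.Probability.Percolation.BoxCrossingProofs

/-!
# Stub `stub_faithful` (K1), line `Sketch` of crux `SquareFromVoronoiHub` — Part 7:
# last exit from the boundary collar (pure topology of conformal rectangles)

Crux `Summit.CriticalPhenomena.CardyFormulaZ2.Theses.CardyFlipRusso.SquareFromVoronoiHub`
(stmt-CriticalPhenomena-6434), line `Sketch` (card `voronoi-blocks-on-fixed-gs`), stub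
`stub_faithful` (K1); registered sub-goal `stub_faithful_part7`.  The purely topological half of
the boundary layer (no lattice, no probability, NO regularity of the Jordan curve `∂Ω`), split off
Part 2 so that it does not wait for Part 1:

* `mem_of_dist_lt_infDist_frontier`: a point closer to `p ∈ Ω` than `p` is to `∂Ω` lies in `Ω`;
* **`exists_collar_exit` (last exit from the collar)**: a path starting within `M` of the arc
  `(ab)` and coming within `M` of `(cd)`, at distance `> M` from `(bc)`, `(da)` (`M` so small that
  nothing is within `M` of both `(ab)` and `(cd)`), unable to make that passage off `closure Ω`,
  has a sub-path `[a₀, b₀]` from within `M` of `(ab)` to within `M` of `(cd)` running at distance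
  `≥ M` from `∂Ω = (ab) ∪ (bc) ∪ (cd) ∪ (da)`, inside `Ω` — so that (Part 2) the sites of `δ • G_s`
  within `δ/2` of it are inside `Ω` and the lattice shadow applies with the crux's `2δ` slack
  (`δ` collar + `δ/2` covering radius);
* `eventually_lt_infDist_arc_two`: from `(ab) ∩ (cd) = ∅` (the tree's
  `MarkedDomain.disjoint_arc_zero_arc_two`), the separation hypothesis `h02` of the collar lemma
  holds for all small `δ > 0`.
-/

noncomputable section

namespace Summit.CriticalPhenomena.CardyFormulaZ2.Cruxes.SquareFromVoronoiHub.VoronoiBlocks.Faithful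

open scoped Topology
open Set Metric Filter
open Literature.Probability.RandomPlanarGeometry (ConformalRectangle)

/-! ### Inside `Ω` by distance to the frontier -/

/-- A point closer to `p ∈ Ω` (`Ω` open) than `p` is to `∂Ω` lies in `Ω` (the ball about `p` of
radius `infDist p ∂Ω` is connected, meets `Ω`, and misses `∂Ω`). [folklore] -/
theorem mem_of_dist_lt_infDist_frontier {Ω : Set ℂ} (hΩ : IsOpen Ω) {p z : ℂ} (hp : p ∈ Ω)
    (hz : dist z p < infDist p (frontier Ω)) : z ∈ Ω := by
  have hsub : ball p (infDist p (frontier Ω)) ⊆ Ω := by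
    refine (convex_ball p _).isPreconnected.subset_of_closure_inter_subset hΩ
      ⟨p, mem_ball_self (dist_nonneg.trans_lt hz), hp⟩ ?_
    rintro w ⟨hwc, hwb⟩
    rw [closure_eq_self_union_frontier] at hwc
    rcases hwc with hw | hw
    · exact hw
    · exact absurd (mem_ball'.1 hwb) (not_lt.2 (infDist_le_dist_of_mem (x := p) hw))
  exact hsub (mem_ball.2 hz)

/-! ### Last exit from the collar -/

/-- **Last exit from the collar.**  Let `γ` be a path starting within `M` of the arc
`(ab) = R.arc 0` and coming within `M` of the arc `(cd) = R.arc 2`, staying at distance `> M` from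
the arcs `(bc)`, `(da)`, where `M > 0` is so small that no point is within `M` of both `(ab)` and
`(cd)`; `γ` need NOT lie in `closure Ω` — we only ask that it cannot get from within `M` of `(ab)`
to within `M` of `(cd)` while avoiding `closure Ω` (`hcl`; automatic for paths in `closure Ω`, and
true for paths in the interior of a black cluster crossing two far-apart exterior caps).  Let `b₀`
be the first time `γ` comes within `M` of `(cd)` and `a₀ ≤ b₀` the last time before `b₀` at which
`γ` is within `M` of `(ab)`.  Then `a₀ < b₀`, and on `[a₀, b₀]` the path stays at distance `≥ M`
from `∂Ω = (ab) ∪ (bc) ∪ (cd) ∪ (da)` and inside `Ω` (it misses `∂Ω`, meets `closure Ω`, and is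
connected).  Purely topological: no regularity of the Jordan curve `∂Ω` is used. [folklore] -/
theorem exists_collar_exit (R : ConformalRectangle) {M : ℝ} (hM : 0 < M) {x y : ℂ} (γ : Path x y)
    (hx : infDist x (R.arc 0) ≤ M) (hy : ∃ t, infDist (γ t) (R.arc 2) ≤ M)
    (hcl : ∀ s t : unitInterval, s ≤ t → infDist (γ s) (R.arc 0) ≤ M →
      infDist (γ t) (R.arc 2) ≤ M → ∃ u : unitInterval, s ≤ u ∧ u ≤ t ∧ γ u ∈ closure R.carrier)
    (h1 : ∀ t, M < infDist (γ t) (R.arc 1)) (h3 : ∀ t, M < infDist (γ t) (R.arc 3))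
    (h02 : ∀ z, infDist z (R.arc 0) ≤ M → M < infDist z (R.arc 2)) :
    ∃ a b : ℝ, 0 ≤ a ∧ a < b ∧ b ≤ 1 ∧ infDist (γ.extend a) (R.arc 0) ≤ M ∧
      infDist (γ.extend b) (R.arc 2) ≤ M ∧
      ∀ t ∈ Icc a b, γ.extend t ∈ R.carrier ∧ M ≤ infDist (γ.extend t) (frontier R.carrier) := by
  set f0 : ℝ → ℝ := fun t => infDist (γ.extend t) (R.arc 0) with hf0d
  set f2 : ℝ → ℝ := fun t => infDist (γ.extend t) (R.arc 2) with hf2d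
  have hf0 : Continuous f0 := (continuous_infDist_pt _).comp γ.continuous_extend
  have hf2 : Continuous f2 := (continuous_infDist_pt _).comp γ.continuous_extend
  -- `b`: the first time within `M` of `(cd)`
  obtain ⟨t₂, ht₂⟩ := hy
  set S2 : Set ℝ := Icc 0 1 ∩ {t | f2 t ≤ M} with hS2
  have hS2c : IsClosed S2 := isClosed_Icc.inter (isClosed_le hf2 continuous_const)
  have h1S2 : (t₂ : ℝ) ∈ S2 := by
    refine ⟨t₂.2, ?_⟩
    show infDist (γ.extend t₂) (R.arc 2) ≤ M
    rwa [γ.extend_extends']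
  have hS2bdd : BddBelow S2 := ⟨0, fun t ht => ht.1.1⟩
  set b := sInf S2 with hb
  have hbS2 : b ∈ S2 := hS2c.csInf_mem ⟨t₂, h1S2⟩ hS2bdd
  have hb1 : b ≤ 1 := hbS2.1.2
  have hb0 : 0 ≤ b := hbS2.1.1
  -- `a`: the last time before `b` within `M` of `(ab)`
  set S0 : Set ℝ := Icc 0 b ∩ {t | f0 t ≤ M} with hS0
  have hS0c : IsClosed S0 := isClosed_Icc.inter (isClosed_le hf0 continuous_const)
  have h0S0 : (0 : ℝ) ∈ S0 := by
    refine ⟨⟨le_rfl, hb0⟩, ?_⟩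
    show infDist (γ.extend 0) (R.arc 0) ≤ M
    rwa [γ.extend_zero]
  have hS0bdd : BddAbove S0 := ⟨b, fun t ht => ht.1.2⟩
  set a := sSup S0 with ha
  have haS0 : a ∈ S0 := hS0c.csSup_mem ⟨0, h0S0⟩ hS0bdd
  have ha0 : 0 ≤ a := haS0.1.1
  have hab : a ≤ b := haS0.1.2
  have hab' : a < b := by
    rcases hab.lt_or_eq with h | h
    · exact h
    · exfalso
      have h0 : f0 a ≤ M := haS0.2
      have h2 : f2 a ≤ M := by rw [h]; exact hbS2.2
      exact (h02 _ h0).not_ge h2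
  -- strictly between `a` and `b` the path is `> M` away from `(ab)` and `(cd)` ...
  have hIoo : ∀ t ∈ Ioo a b, M < f0 t ∧ M < f2 t := by
    intro t ht
    have ht01 : t ∈ Icc (0 : ℝ) 1 := ⟨ha0.trans ht.1.le, ht.2.le.trans hb1⟩
    constructor
    · refine not_le.1 fun hle => ?_
      have : t ∈ S0 := ⟨⟨ha0.trans ht.1.le, ht.2.le⟩, hle⟩
      exact (le_csSup hS0bdd this).not_gt ht.1
    · refine not_le.1 fun hle => ?_
      have : t ∈ S2 := ⟨ht01, hle⟩
      exact (csInf_le hS2bdd this).not_gt ht.2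
  -- ... hence (closedness) `≥ M` away on `[a, b]`
  have hIcc : ∀ t ∈ Icc a b, M ≤ f0 t ∧ M ≤ f2 t := by
    have hG : IsClosed {t | M ≤ f0 t ∧ M ≤ f2 t} :=
      (isClosed_le continuous_const hf0).inter (isClosed_le continuous_const hf2)
    have hsub : Ioo a b ⊆ {t | M ≤ f0 t ∧ M ≤ f2 t} := fun t ht => ⟨(hIoo t ht).1.le, (hIoo t ht).2.le⟩
    have hcl' := closure_minimal hsub hG
    rw [closure_Ioo hab'.ne] at hcl'
    exact fun t ht => hcl' ht
  have hfr : ⋃ i, R.arc i = frontier R.carrier := R.iUnion_arc_holds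
  -- distance `≥ M` from every arc, hence from the frontier
  have hM' : ∀ t ∈ Icc a b, M ≤ infDist (γ.extend t) (frontier R.carrier) := by
    intro t ht
    have ht01 : t ∈ Icc (0 : ℝ) 1 := ⟨ha0.trans ht.1, ht.2.trans hb1⟩
    have hext : γ.extend t = γ ⟨t, ht01⟩ := Path.extend_apply γ ht01
    rw [le_infDist ⟨R.pt 0, R.arc_subset_frontier 0 (R.pt_mem_arc_self 0)⟩]
    intro w hw
    rw [← hfr, mem_iUnion] at hw
    obtain ⟨i, hi⟩ := hw
    refine le_trans ?_ (infDist_le_dist_of_mem hi)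
    fin_cases i
    · exact (hIcc t ht).1
    · rw [hext]; exact (h1 _).le
    · exact (hIcc t ht).2
    · rw [hext]; exact (h3 _).le
  have hnotfr : ∀ t ∈ Icc a b, γ.extend t ∉ frontier R.carrier := fun t ht hfr' => by
    have h := hM' t ht
    rw [infDist_zero_of_mem hfr'] at h
    exact h.not_gt hM
  -- one point of the sub-path lies in `closure Ω`, hence in `Ω` ...
  have ha01 : a ∈ Icc (0 : ℝ) 1 := ⟨ha0, hab.trans hb1⟩
  have hb01 : b ∈ Icc (0 : ℝ) 1 := ⟨hb0, hb1⟩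
  have hfa : infDist (γ ⟨a, ha01⟩) (R.arc 0) ≤ M := by
    rw [← Path.extend_apply γ ha01]; exact haS0.2
  have hfb : infDist (γ ⟨b, hb01⟩) (R.arc 2) ≤ M := by
    rw [← Path.extend_apply γ hb01]; exact hbS2.2
  obtain ⟨u, hau, hub, hu⟩ := hcl ⟨a, ha01⟩ ⟨b, hb01⟩ hab hfa hfb
  have hu' : (u : ℝ) ∈ Icc a b := ⟨hau, hub⟩
  have huΩ : γ.extend u ∈ R.carrier := by
    rw [γ.extend_extends']
    rw [closure_eq_self_union_frontier] at hu
    rcases hu with hu | hu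
    · exact hu
    · exact absurd (by rwa [γ.extend_extends'] : γ.extend u ∈ frontier R.carrier) (hnotfr u hu')
  -- ... and the sub-path is connected and misses `∂Ω`, so it lies in `Ω`
  have hS : γ.extend '' Icc a b ⊆ R.carrier := by
    refine (isPreconnected_Icc.image _ γ.continuous_extend.continuousOn).subset_left_of_subset_union
      R.isOpen isClosed_closure.isOpen_compl (disjoint_compl_right_iff_subset.2 subset_closure)
      ?_ ⟨γ.extend u, mem_image_of_mem _ hu', huΩ⟩
    rintro _ ⟨t, ht, rfl⟩
    by_cases hz : γ.extend t ∈ closure R.carrier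
    · rw [closure_eq_self_union_frontier] at hz
      rcases hz with hz | hz
      · exact Or.inl hz
      · exact absurd hz (hnotfr t ht)
    · exact Or.inr hz
  exact ⟨a, b, ha0, hab', hb1, haS0.2, hbS2.2, fun t ht => ⟨hS (mem_image_of_mem _ ht), hM' t ht⟩⟩

/-! ### The separation hypothesis `h02`, eventually -/

/-- **The separation hypothesis, eventually**: for all small `δ > 0` no point is within `δ` of
both `(ab)` and `(cd)` (the two arcs are disjoint compact sets — the tree's
`MarkedDomain.disjoint_arc_zero_arc_two` — at distance `m > 0`; take `δ < m/2`).  This discharges the hypothesis `h02` of `exists_collar_exit` and of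
`blockConfig_mem_crudeCrossing_of_robust_path` / `…_of_path` along `δ → 0⁺`. [folklore] -/
theorem eventually_lt_infDist_arc_two (R : ConformalRectangle) :
    ∀ᶠ δ in 𝓝[>] (0 : ℝ), ∀ z : ℂ, infDist z (R.arc 0) ≤ δ → δ < infDist z (R.arc 2) := by
  have hne0 : (R.arc 0).Nonempty := ⟨R.pt 0, R.pt_mem_arc_self 0⟩
  have hne2 : (R.arc 2).Nonempty := ⟨R.pt 2, R.pt_mem_arc_self 2⟩
  -- the minimum `m > 0` over `(ab)` of the distance to `(cd)`
  obtain ⟨x₀, hx₀, hmin⟩ := (R.isCompact_arc 0).exists_isMinOn hne0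
    ((continuous_infDist_pt (R.arc 2)).continuousOn)
  set m := infDist x₀ (R.arc 2) with hm
  have hm0 : 0 < m :=
    ((R.isClosed_arc 2).notMem_iff_infDist_pos hne2).1
      (Set.disjoint_left.1 R.disjoint_arc_zero_arc_two hx₀)
  have hev : ∀ᶠ δ in 𝓝[>] (0 : ℝ), δ < m / 2 := by
    filter_upwards [Ioo_mem_nhdsGT (show (0 : ℝ) < m / 2 by positivity)] with δ hδ using hδ.2
  filter_upwards [hev] with δ hδ z hz
  -- a nearest point `x ∈ (ab)` of `z`, and the triangle inequality
  obtain ⟨x, hx, hxz⟩ := (R.isCompact_arc 0).exists_infDist_eq_dist hne0 z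
  have h1 : m ≤ infDist x (R.arc 2) := hmin hx
  have h2 : infDist x (R.arc 2) ≤ infDist z (R.arc 2) + dist x z := infDist_le_infDist_add_dist
  rw [dist_comm, ← hxz] at h2
  linarith

/-- **Registered sub-goal `stub_faithful_part7`** of `stub_faithful` (K1): last exit from the
collar of `∂Ω` (the statement of `exists_collar_exit`). [folklore] -/
theorem stub_faithful_part7 : ∀ (R : ConformalRectangle) {M : ℝ}, 0 < M → ∀ {x y : ℂ} (γ : Path x y), Metric.infDist x (R.arc 0) ≤ M → (∃ t, Metric.infDist (γ t) (R.arc 2) ≤ M) → (∀ t₁ t₂ : unitInterval, t₁ ≤ t₂ → Metric.infDist (γ t₁) (R.arc 0) ≤ M → Metric.infDist (γ t₂) (R.arc 2) ≤ M → ∃ u : unitInterval, t₁ ≤ u ∧ u ≤ t₂ ∧ γ u ∈ closure R.carrier) → (∀ t, M < Metric.infDist (γ t) (R.arc 1)) → (∀ t, M < Metric.infDist (γ t) (R.arc 3)) → (∀ z, Metric.infDist z (R.arc 0) ≤ M → M < Metric.infDist z (R.arc 2)) → ∃ a b : ℝ, 0 ≤ a ∧ a < b ∧ b ≤ 1 ∧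 Metric.infDist (γ.extend a) (R.arc 0) ≤ M ∧ Metric.infDist (γ.extend b) (R.arc 2) ≤ M ∧ ∀ t ∈ Set.Icc a b, γ.extend t ∈ R.carrier ∧ M ≤ Metric.infDist (γ.extend t) (frontier R.carrier) :=
  fun R _ hM _ _ γ hx hy hcl h1 h3 h02 => exists_collar_exit R hM γ hx hy hcl h1 h3 h02

end Summit.CriticalPhenomena.CardyFormulaZ2.Cruxes.SquareFromVoronoiHub.VoronoiBlocks.Faithful

end
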